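import Summits.BirchSwinnertonDyer.Rank1Residual.Additive.XGordRankZeroCyclotomicPrime
import Summits.BirchSwinnertonDyer.Rank1Residual.Additive.CyclotomicPrimeReduction
import Summits.BirchSwinnertonDyer.Rank1Residual.Additive.X4RankZeroSemistableTwistOddSurj
import Literature.NumberTheory.EllipticCurves.Greenberg1999.EulerCharacteristicNumberField
import Literature.NumberTheory.EllipticCurves.Wuthrich2014.ReducibleDivisibilityCyclotomicPrime
import Literature.NumberTheory.EllipticCurves.Kato2004.BigImageDivisibilityCyclotomicPrime
import HarnessLib

/-!
# Line V19 from named facts only: X3 (Wuthrich Thm. 16, all branches) and X4 (Kato Thm. 17.4 (3), all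
# branches) ∧ (G-ord, `e = 2`) ∧ ranks `(0,0)` at an odd prime `p`, over `F = ℚ(ζ_p)`

HONEST FRAMING (cell `b2b-bsdres`, run/shared/lean/b2b/bsd-rank1-residual/, verbatim in every
file): the goal of the cell is to DELETE the COMBINATION-SHAPED residual classes of the
Birch–Swinnerton-Dyer formula for ALL analytic-rank `≤ 1` elliptic curves over `ℚ` — "full BSD
formula for every rank `≤ 1` curve in class `C`" assembled STRICTLY from published theorems — so
that the rank-`≤ 1` remainder becomes exactly the CONSTRUCTION-SHAPED classes, which are TYPED
(missing-input `Prop`s), NOT attempted. This is not "finishing BSD". Seat additive-p4 (research route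
on X3/X4); the labels of X3 and X4 are UNCHANGED by this file; nothing is booked here.

Theorems only (no `def`, no `sorry`, no new named fact):
* `XGordCyclotomicPrime.greenbergF_of_fact` — the inline hypothesis `hGrF` of the core theorem
  (`XGordRankZeroCyclotomicPrime.lean`) DERIVED from the verbatim number-field statement
  `Greenberg1999.thm41_charValue_rankZero_numberField` and the `ℚ(ζ_p)`-side reduction data
  (`CyclotomicPrimeReduction`: ONE prime `𝔭 = (ζ_p − 1)` over `p`, `N𝔭 = p`, `V ⊗ F` minimal and good
  at `𝔭`, `a_𝔭 = a_p`, `#Ẽ_𝔭(k_𝔭)[p^∞] = #V(𝔽_p)[p^∞]`);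
* `X3GordCyclotomicPrime.exists_padicVal_shaOrder_add_le_of_facts` /
  `X4GordCyclotomicPrime.exists_padicVal_shaOrder_add_le_of_facts` — the core inequality for a good
  ordinary `V` with `V[p]` REDUCIBLE (X3; Wuthrich 2014 Thm. 16, named fact
  `charIdeal_dvd_padicLFunction_cyclotomicPrime`) resp. with `ρ̄_{W,p}` SURJECTIVE and `p ≥ 5` (X4; Kato
  2004 Thm. 17.4 (3), named fact `charIdeal_dvd_padicLFunction_cyclotomicPrime_of_surjective`; `p`-adic
  surjectivity of `V` from `surj(p)` of `W` by Serre's lemma and twist invariance), `F` instantiated as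
  `CyclotomicField p ℚ`;
* `…bsdp_of_units_of_facts` — on the rows where every explicit term is a `p`-adic unit
  (`#Ш_an(V)`, `#Ш_an(W)`, `∏c(V)·∏c(W)`, `#V(F)`, `ϖ`, `ϖ'`, and the other branch values `o`):
  **`BSD(W,p) ∧ BSD(V,p)`** for the ADDITIVE pair `(W,p)` (X3 resp. X4, Kodaira `I₀*`, `p ≥ 5`) and its
  good ordinary twist pair `(V,p)` simultaneously — from the named facts, modularity and GZK alone.

Census (cell, N < 2·10⁴; per-pair data `o`, `#V(F)`, `∏_w c_w(V_F)`, `ϖ`, `ϖ'` = instrument request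
R12, HOME/b2b-bsdres-additive-p4/REQUESTS.md): X3 ∧ (G-ord, e=2) at `p ∈ {5,7}` and X4 ∧ (G-ord, e=2)
at `p ≥ 5`. Labels UNCHANGED; nothing booked.
-/

noncomputable section

open scoped Classical MatrixGroups ModularForm

open CongruenceSubgroup WeierstrassCurve NumberField IsDedekindDomain
  Literature.NumberTheory.EllipticCurves Literature.NumberTheory.EllipticCurves.ModularForms
  Literature.NumberTheory.EllipticCurves.Rank1Residual
  Literature.NumberTheory.EllipticCurves.Rank1Residual.Typed
  Literature.NumberTheory.GaloisRepresentations

namespace Summit.BirchSwinnertonDyer.Rank1Residual.Additive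

/-! ## §1 `hGrF` from Greenberg's Theorem 4.1 over number fields -/

section GreenbergF

variable (p : ℕ) [hp : Fact p.Prime] (F : Type) [Field F] [NumberField F] [IsCyclotomicExtension {p} ℚ F]
  (V : WeierstrassCurve ℚ) [V.IsElliptic] [V.IsGloballyMinimal]

/-- **Greenberg's Theorem 4.1 for `V_F`, `F = ℚ(ζ_p)`, in the `F`-shape of line V19** (the inline
hypothesis `hGrF` of `XGordCyclotomicPrime.exists_padicVal_shaOrder_add_le`), DERIVED from the
verbatim number-field statement `Greenberg1999.thm41_charValue_rankZero_numberField`: for `V/ℚ`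
globally minimal good ordinary at the odd prime `p`, the only prime of `F` above `p` is
`𝔭 = (ζ_p − 1)` with `k_𝔭 = 𝔽_p`, `V_F` has good ordinary reduction there with `a_𝔭(V_F) = a_p(V)`,
and `#Ẽ_𝔭(k_𝔭)[p^∞] = #V(𝔽_p)[p^∞]` (`CyclotomicPrimeReduction.exists_unique_prime_reduction_data`).
[cite: GreenbergLNM1716, Thm. 4.1 (p. 102)] -/
theorem XGordCyclotomicPrime.greenbergF_of_fact
    (hGr : Greenberg1999.thm41_charValue_rankZero_numberField) (hp2 : p ≠ 2)
    (hord : IsOrdinaryAt V p) :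
    ∀ (κ : ZpExtension F p) (γ : Field.absoluteGaloisGroup F),
        κ.IsCyclotomic → κ.IsTopGenerator γ →
      ∀ (D : (V.baseChange F).SelmerDualData κ γ) [Module.Finite (IwasawaAlgebra p) D.X], D.IsTorsion →
      ∀ (fE : IwasawaAlgebra p), D.charIdeal = Ideal.span {fE} →
        Finite ((V.baseChange F).selmerGroupPInfty p) →
        ∃ u : ℤ_[p]ˣ,
          ((PowerSeries.constantCoeff fE : ℤ_[p]) : ℚ_[p]) *
              (Nat.card (AddCommGroup.primaryComponent (V.baseChange F).toAffine.Point p) : ℚ_[p]) ^ 2 =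
            ((u : ℤ_[p]) : ℚ_[p]) * (p : ℚ_[p]) ^ (padicValNat p (V.baseChange F).tamagawaProduct) *
              (Nat.card (AddCommGroup.primaryComponent
                ((integralModelInt V).map (Int.castRingHom (ZMod p))).toAffine.Point p) : ℚ_[p]) ^ 2 *
              (Nat.card ((V.baseChange F).selmerGroupPInfty p) : ℚ_[p]) := by
  intro κ γ hκ hγ D _ hX fE hfE hfin
  haveI : (V.baseChange F).IsElliptic := by rw [baseChange]; infer_instance
  obtain ⟨𝔭, hmem, hS, hN, -, hgood, hfrob, hcard⟩ :=
    exists_unique_prime_reduction_data (K := F) V p hord.1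
  have hordF : ¬ ((p : ℕ) : ℤ) ∣ (V.baseChange F).frobeniusTraceAt 𝔭 := by
    rw [hfrob]
    exact hord.2
  obtain ⟨u, hu⟩ := hGr.of_unique_prime (V.baseChange F) p hp2 𝔭 hS hgood hordF κ γ hκ hγ
    D hX fE hfE hfin
  refine ⟨u, ?_⟩
  rw [hu, hcard]

end GreenbergF

/-! ## §2 X3: Wuthrich's Theorem 16 (all branches) — `V[p]` reducible -/

section Facts

variable (p : ℕ) [hp : Fact p.Prime]
  (V : WeierstrassCurve ℚ) [V.IsElliptic] [V.IsGloballyMinimal]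
  (W : WeierstrassCurve ℚ) [W.IsElliptic] [W.IsGloballyMinimal]

/-- **Line V19 for X3, from named facts only.** Let `p` be an odd prime, `V/ℚ` globally minimal,
good ORDINARY at `p` with `V[p]` REDUCIBLE, and `W = C • V^{(p*)}` a globally minimal model of its
twist by `p* = (−1)^{(p−1)/2}p`, ADDITIVE at `p` (the X3 ∧ (G-ord, `e = 2`) situation), both of
analytic rank `0`; `f` the newform of `V`, `ϖ·Ω_V = Ω⁺_f`, `ϖ'·|Ω⁻(V)| = Ω⁻_f`; assume the other branch
values `o = ∏_{i ∉ {0,(p−1)/2}} L_p(f,α,ω^i,0)` are non-zero. Then `#Ш_an(V) = q_V`,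
`#Ш_an(W) = q_W` are rationals satisfying the inequality of
`XGordCyclotomicPrime.exists_padicVal_shaOrder_add_le` with `F = ℚ(ζ_p) = CyclotomicField p ℚ`,
granted EXACTLY: Wuthrich 2014 Thm. 16 over `ℚ(ζ_{p^∞})` (`hW`, named fact), Greenberg 1999 Thm. 4.1
over number fields (`hGr`, named fact), modularity (`hmod`) and Gross–Zagier–Kolyvagin (`hGZK`).
[cite: Wuthrich2014, Thm. 16 (p. 397)] [cite: GreenbergLNM1716, Thm. 4.1 (p. 102)] -/
theorem X3GordCyclotomicPrime.exists_padicVal_shaOrder_add_le_of_facts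
    (hW : Wuthrich2014.charIdeal_dvd_padicLFunction_cyclotomicPrime)
    (hGr : Greenberg1999.thm41_charValue_rankZero_numberField)
    (hGZK : rank_eq_analyticRank_of_analyticRank_le_one) (hmod : hasEntireLFunction_rat)
    (hp2 : p ≠ 2) (C : VariableChange ℚ) (hC : C • V.quadraticTwist ((-1 : ℚ) ^ (p / 2) * p) = W)
    (hord : IsOrdinaryAt V p) (hred : ¬ V.HasIrreducibleModPGaloisRep p) (hadd : Addv W p)
    (hrV : V.analyticRank = 0) (hrW : W.analyticRank = 0)
    {N : ℕ} [NeZero N] {f : CuspForm (Gamma0 N) 2} (hf : IsNewformOf V f)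
    (ϖ ϖ' : ℚ) (hϖ : (ϖ : ℝ) * V.realPeriodRat = plusPeriod f)
    (hϖ' : (ϖ' : ℝ) * V.imaginaryPeriodRat = minusPeriod f)
    (hO : (∏ i ∈ ((Finset.range (p - 1)).erase 0).erase (p / 2),
        PowerSeries.constantCoeff
          (if Even i then padicLFunctionBranch f ((unitRoot V p : ℤ_[p]) : ℚ_[p]) i
            else padicLFunctionMinusBranch f ((unitRoot V p : ℤ_[p]) : ℚ_[p]) i)) ≠ 0) :
    ∃ qV qW : ℚ, shaAn V = (qV : ℂ) ∧ shaAn W = (qW : ℂ) ∧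
      (padicValNat p V.shaOrder : ℤ) + padicValNat p W.shaOrder +
            padicValNat p (V.baseChange (CyclotomicField p ℚ)).tamagawaProduct +
            2 * (padicValNat p (Nat.card V.toAffine.Point) + padicValNat p (Nat.card W.toAffine.Point)) ≤
        padicValRat p qV + padicValRat p qW +
          padicValNat p V.tamagawaProduct + padicValNat p W.tamagawaProduct +
          2 * padicValNat p (Nat.card (V.baseChange (CyclotomicField p ℚ)).toAffine.Point) +
          (∏ i ∈ ((Finset.range (p - 1)).erase 0).erase (p / 2),
              PowerSeries.constantCoeff
                (if Even i then padicLFunctionBranch f ((unitRoot V p : ℤ_[p]) : ℚ_[p]) i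
                  else padicLFunctionMinusBranch f ((unitRoot V p : ℤ_[p]) : ℚ_[p]) i)).valuation +
          ((p / 2 : ℕ) : ℤ) * (padicValRat p ϖ + padicValRat p ϖ') - padicValRat p ϖ -
          (if p % 4 = 1 then padicValRat p ϖ else padicValRat p ϖ') := by
  haveI : IsCyclotomicExtension {p} ℚ (CyclotomicField p ℚ) := CyclotomicField.isCyclotomicExtension p ℚ
  haveI : (V.baseChange (CyclotomicField p ℚ)).IsElliptic := by rw [baseChange]; infer_instance
  exact XGordCyclotomicPrime.exists_padicVal_shaOrder_add_le p (CyclotomicField p ℚ) V W hGZK hmod hp2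
    C hC hord hadd hrV hrW hf ϖ ϖ' hϖ hϖ'
    (fun κ γ hκ hγ hγ' D ↦ hW p V (CyclotomicField p ℚ) (V.baseChange (CyclotomicField p ℚ)) hp2 hord
      hred ⟨1, one_smul _ _⟩ hκ hγ hγ' hf D ϖ ϖ' hϖ hϖ')
    (XGordCyclotomicPrime.greenbergF_of_fact p (CyclotomicField p ℚ) V hGr hp2 hord) hO

/-- **`BSD(W,p) ∧ BSD(V,p)` on the unit rows (X3), from named facts only.** In the situation of
`X3GordCyclotomicPrime.exists_padicVal_shaOrder_add_le_of_facts`, if `#Ш_an(V)`, `#Ш_an(W)` are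
`p`-adic units and the explicit terms satisfy `ord_p∏c(V) + ord_p∏c(W) + 2 ord_p#V(ℚ(ζ_p)) + [v(o) +
m(ord_p ϖ + ord_p ϖ') − ord_p ϖ − ord_p ϖ_mid] ≤ 2(ord_p#V(ℚ) + ord_p#W(ℚ))` (a per-pair CERTIFICATE:
Tamagawa numbers, torsion over `ℚ(ζ_p)`, and the Néron-normalised other-branch values), then Miller's `BSD(W,p)` and `BSD(V,p)` hold — for the ADDITIVE X3 pair `(W,p)` (type `I₀*`, `W[p]`
reducible) and its good ordinary Eisenstein twist pair `(V,p)` simultaneously; moreover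
`p ∤ ∏_w c_w(V_F)`. Inputs: two named published facts (`hW`, `hGr`), modularity, GZK — nothing else.
Labels UNCHANGED; nothing booked by this theorem.
[cite: Wuthrich2014, Thm. 16 (p. 397)] [cite: GreenbergLNM1716, Thm. 4.1 (p. 102)] -/
theorem X3GordCyclotomicPrime.bsdp_of_units_of_facts
    (hW : Wuthrich2014.charIdeal_dvd_padicLFunction_cyclotomicPrime)
    (hGr : Greenberg1999.thm41_charValue_rankZero_numberField)
    (hGZK : rank_eq_analyticRank_of_analyticRank_le_one) (hmod : hasEntireLFunction_rat)
    (hp2 : p ≠ 2) (C : VariableChange ℚ) (hC : C • V.quadraticTwist ((-1 : ℚ) ^ (p / 2) * p) = W)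
    (hord : IsOrdinaryAt V p) (hred : ¬ V.HasIrreducibleModPGaloisRep p) (hadd : Addv W p)
    (hrV : V.analyticRank = 0) (hrW : W.analyticRank = 0)
    {N : ℕ} [NeZero N] {f : CuspForm (Gamma0 N) 2} (hf : IsNewformOf V f)
    (ϖ ϖ' : ℚ) (hϖ : (ϖ : ℝ) * V.realPeriodRat = plusPeriod f)
    (hϖ' : (ϖ' : ℝ) * V.imaginaryPeriodRat = minusPeriod f)
    (hO : (∏ i ∈ ((Finset.range (p - 1)).erase 0).erase (p / 2),
        PowerSeries.constantCoeff
          (if Even i then padicLFunctionBranch f ((unitRoot V p : ℤ_[p]) : ℚ_[p]) i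
            else padicLFunctionMinusBranch f ((unitRoot V p : ℤ_[p]) : ℚ_[p]) i)) ≠ 0)
    (hslack : (padicValNat p V.tamagawaProduct : ℤ) + padicValNat p W.tamagawaProduct +
        2 * padicValNat p (Nat.card (V.baseChange (CyclotomicField p ℚ)).toAffine.Point) +
        ((∏ i ∈ ((Finset.range (p - 1)).erase 0).erase (p / 2),
          PowerSeries.constantCoeff
            (if Even i then padicLFunctionBranch f ((unitRoot V p : ℤ_[p]) : ℚ_[p]) i
              else padicLFunctionMinusBranch f ((unitRoot V p : ℤ_[p]) : ℚ_[p]) i)).valuation +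
          ((p / 2 : ℕ) : ℤ) * (padicValRat p ϖ + padicValRat p ϖ') - padicValRat p ϖ -
          (if p % 4 = 1 then padicValRat p ϖ else padicValRat p ϖ')) ≤
        2 * (padicValNat p (Nat.card V.toAffine.Point) + padicValNat p (Nat.card W.toAffine.Point)))
    {qV qW : ℚ} (hqV : shaAn V = (qV : ℂ)) (hqW : shaAn W = (qW : ℂ))
    (hvV : padicValRat p qV = 0) (hvW : padicValRat p qW = 0) :
    BSDp W p ∧ BSDp V p ∧ padicValNat p (V.baseChange (CyclotomicField p ℚ)).tamagawaProduct = 0 := by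
  obtain ⟨qV', qW', hqV', hqW', hle⟩ := X3GordCyclotomicPrime.exists_padicVal_shaOrder_add_le_of_facts
    p V W hW hGr hGZK hmod hp2 C hC hord hred hadd hrV hrW hf ϖ ϖ' hϖ hϖ' hO
  have hqq : qV' = qV := by exact_mod_cast hqV'.symm.trans hqV
  have hqq' : qW' = qW := by exact_mod_cast hqW'.symm.trans hqW
  subst hqq hqq'
  rw [hvV, hvW] at hle
  have hV0 : (0 : ℤ) ≤ padicValNat p V.shaOrder := by positivity
  have hW0 : (0 : ℤ) ≤ padicValNat p W.shaOrder := by positivity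
  have hT0 : (0 : ℤ) ≤ padicValNat p (V.baseChange (CyclotomicField p ℚ)).tamagawaProduct := by positivity
  have huW : MissingUpperBoundAt W p := ⟨qW', hqW', by rw [hvW]; linarith⟩
  have huV : MissingUpperBoundAt V p := ⟨qV', hqV', by rw [hvV]; linarith⟩
  refine ⟨bsdp_of_missingPPartAt W p hGZK (by rw [hrW]; exact zero_le_one)
      (missingPPartAt_of_upper_of_shaAn_unit W p huW hqW' hvW),
    bsdp_of_missingPPartAt V p hGZK (by rw [hrV]; exact zero_le_one)
      (missingPPartAt_of_upper_of_shaAn_unit V p huV hqV' hvV), ?_⟩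
  have : (padicValNat p (V.baseChange (CyclotomicField p ℚ)).tamagawaProduct : ℤ) ≤ 0 := by linarith
  exact_mod_cast le_antisymm this hT0

/-! ## §3 X4: Kato's Theorem 17.4 (3) (all branches) — `ρ̄_{W,p}` surjective, `p ≥ 5` -/

/-- **Line V19 for X4, from named facts only.** As
`X3GordCyclotomicPrime.exists_padicVal_shaOrder_add_le_of_facts`, with `V[p]` reducible replaced by
`ρ̄_{W,p}` SURJECTIVE (census bit `surj(p)` of the additive curve `W`) and `p ≥ 5`: `Surj` is a
quadratic-twist invariant and Serre's lemma lifts it to `ρ_{V,p^∞}` onto, i.e. Kato's (12.5.2)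
(`X4RankZeroTwistOdd.forall_surj_pow_twist_of_surj`); the divisibility is Kato 2004 Thm. 17.4 (3)
over `ℚ(ζ_{p^∞})` (`hK`, named fact `charIdeal_dvd_padicLFunction_cyclotomicPrime_of_surjective`).
[cite: Kato2004Asterisque, Thm. 17.4 (3) (p. 273)] [cite: GreenbergLNM1716, Thm. 4.1 (p. 102)]
[cite: SerreAbelianLadic1968, Ch. IV §3.4, Lemma 3] -/
theorem X4GordCyclotomicPrime.exists_padicVal_shaOrder_add_le_of_facts
    (hK : Kato2004.charIdeal_dvd_padicLFunction_cyclotomicPrime_of_surjective)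
    (hGr : Greenberg1999.thm41_charValue_rankZero_numberField)
    (hGZK : rank_eq_analyticRank_of_analyticRank_le_one) (hmod : hasEntireLFunction_rat)
    (hp5 : 5 ≤ p) (C : VariableChange ℚ) (hC : C • V.quadraticTwist ((-1 : ℚ) ^ (p / 2) * p) = W)
    (hord : IsOrdinaryAt V p) (hsurj : Surj W p) (hadd : Addv W p)
    (hrV : V.analyticRank = 0) (hrW : W.analyticRank = 0)
    {N : ℕ} [NeZero N] {f : CuspForm (Gamma0 N) 2} (hf : IsNewformOf V f)
    (ϖ ϖ' : ℚ) (hϖ : (ϖ : ℝ) * V.realPeriodRat = plusPeriod f)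
    (hϖ' : (ϖ' : ℝ) * V.imaginaryPeriodRat = minusPeriod f)
    (hO : (∏ i ∈ ((Finset.range (p - 1)).erase 0).erase (p / 2),
        PowerSeries.constantCoeff
          (if Even i then padicLFunctionBranch f ((unitRoot V p : ℤ_[p]) : ℚ_[p]) i
            else padicLFunctionMinusBranch f ((unitRoot V p : ℤ_[p]) : ℚ_[p]) i)) ≠ 0) :
    ∃ qV qW : ℚ, shaAn V = (qV : ℂ) ∧ shaAn W = (qW : ℂ) ∧
      (padicValNat p V.shaOrder : ℤ) + padicValNat p W.shaOrder +
            padicValNat p (V.baseChange (CyclotomicField p ℚ)).tamagawaProduct +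
            2 * (padicValNat p (Nat.card V.toAffine.Point) + padicValNat p (Nat.card W.toAffine.Point)) ≤
        padicValRat p qV + padicValRat p qW +
          padicValNat p V.tamagawaProduct + padicValNat p W.tamagawaProduct +
          2 * padicValNat p (Nat.card (V.baseChange (CyclotomicField p ℚ)).toAffine.Point) +
          (∏ i ∈ ((Finset.range (p - 1)).erase 0).erase (p / 2),
              PowerSeries.constantCoeff
                (if Even i then padicLFunctionBranch f ((unitRoot V p : ℤ_[p]) : ℚ_[p]) i
                  else padicLFunctionMinusBranch f ((unitRoot V p : ℤ_[p]) : ℚ_[p]) i)).valuation +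
          ((p / 2 : ℕ) : ℤ) * (padicValRat p ϖ + padicValRat p ϖ') - padicValRat p ϖ -
          (if p % 4 = 1 then padicValRat p ϖ else padicValRat p ϖ') := by
  haveI : IsCyclotomicExtension {p} ℚ (CyclotomicField p ℚ) := CyclotomicField.isCyclotomicExtension p ℚ
  haveI : (V.baseChange (CyclotomicField p ℚ)).IsElliptic := by rw [baseChange]; infer_instance
  have hp2 : p ≠ 2 := by omega
  have hd : ((-1 : ℚ) ^ (p / 2) * p) ≠ 0 :=
    mul_ne_zero (pow_ne_zero _ (by norm_num)) (Nat.cast_ne_zero.mpr hp.out.ne_zero)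
  have hsurjV : ∀ n : ℕ, V.HasSurjectiveModNGaloisRep (p ^ n : ℕ) :=
    X4RankZeroTwistOdd.forall_surj_pow_twist_of_surj W p hp5 V hd C hC hsurj
  exact XGordCyclotomicPrime.exists_padicVal_shaOrder_add_le p (CyclotomicField p ℚ) V W hGZK hmod hp2
    C hC hord hadd hrV hrW hf ϖ ϖ' hϖ hϖ'
    (fun κ γ hκ hγ hγ' D ↦ hK p V (CyclotomicField p ℚ) (V.baseChange (CyclotomicField p ℚ)) hp2 hord
      hsurjV ⟨1, one_smul _ _⟩ hκ hγ hγ' hf D ϖ ϖ' hϖ hϖ')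
    (XGordCyclotomicPrime.greenbergF_of_fact p (CyclotomicField p ℚ) V hGr hp2 hord) hO

/-- **`BSD(W,p) ∧ BSD(V,p)` on the unit rows (X4), from named facts only.** In the situation of
`X4GordCyclotomicPrime.exists_padicVal_shaOrder_add_le_of_facts`, if `#Ш_an(V)`, `#Ш_an(W)` are
`p`-adic units and the explicit terms satisfy `ord_p∏c(V) + ord_p∏c(W) + 2 ord_p#V(ℚ(ζ_p)) + [v(o) +
m(ord_p ϖ + ord_p ϖ') − ord_p ϖ − ord_p ϖ_mid] ≤ 2(ord_p#V(ℚ) + ord_p#W(ℚ))` (a per-pair CERTIFICATE: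
Tamagawa numbers, torsion over `ℚ(ζ_p)`, and the Néron-normalised other-branch values), then Miller's `BSD(W,p)` and `BSD(V,p)` hold — for the ADDITIVE X4 pair `(W,p)` (type `I₀*`, `ρ̄_{W,p}`
onto, `p ≥ 5`) and its good ordinary twist pair `(V,p)` simultaneously; moreover
`p ∤ ∏_w c_w(V_F)`. Inputs: two named published facts (`hK`, `hGr`), modularity, GZK — nothing else.
Labels UNCHANGED; nothing booked by this theorem.
[cite: Kato2004Asterisque, Thm. 17.4 (3) (p. 273)] [cite: GreenbergLNM1716, Thm. 4.1 (p. 102)] -/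
theorem X4GordCyclotomicPrime.bsdp_of_units_of_facts
    (hK : Kato2004.charIdeal_dvd_padicLFunction_cyclotomicPrime_of_surjective)
    (hGr : Greenberg1999.thm41_charValue_rankZero_numberField)
    (hGZK : rank_eq_analyticRank_of_analyticRank_le_one) (hmod : hasEntireLFunction_rat)
    (hp5 : 5 ≤ p) (C : VariableChange ℚ) (hC : C • V.quadraticTwist ((-1 : ℚ) ^ (p / 2) * p) = W)
    (hord : IsOrdinaryAt V p) (hsurj : Surj W p) (hadd : Addv W p)
    (hrV : V.analyticRank = 0) (hrW : W.analyticRank = 0)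
    {N : ℕ} [NeZero N] {f : CuspForm (Gamma0 N) 2} (hf : IsNewformOf V f)
    (ϖ ϖ' : ℚ) (hϖ : (ϖ : ℝ) * V.realPeriodRat = plusPeriod f)
    (hϖ' : (ϖ' : ℝ) * V.imaginaryPeriodRat = minusPeriod f)
    (hO : (∏ i ∈ ((Finset.range (p - 1)).erase 0).erase (p / 2),
        PowerSeries.constantCoeff
          (if Even i then padicLFunctionBranch f ((unitRoot V p : ℤ_[p]) : ℚ_[p]) i
            else padicLFunctionMinusBranch f ((unitRoot V p : ℤ_[p]) : ℚ_[p]) i)) ≠ 0)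
    (hslack : (padicValNat p V.tamagawaProduct : ℤ) + padicValNat p W.tamagawaProduct +
        2 * padicValNat p (Nat.card (V.baseChange (CyclotomicField p ℚ)).toAffine.Point) +
        ((∏ i ∈ ((Finset.range (p - 1)).erase 0).erase (p / 2),
          PowerSeries.constantCoeff
            (if Even i then padicLFunctionBranch f ((unitRoot V p : ℤ_[p]) : ℚ_[p]) i
              else padicLFunctionMinusBranch f ((unitRoot V p : ℤ_[p]) : ℚ_[p]) i)).valuation +
          ((p / 2 : ℕ) : ℤ) * (padicValRat p ϖ + padicValRat p ϖ') - padicValRat p ϖ -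
          (if p % 4 = 1 then padicValRat p ϖ else padicValRat p ϖ')) ≤
        2 * (padicValNat p (Nat.card V.toAffine.Point) + padicValNat p (Nat.card W.toAffine.Point)))
    {qV qW : ℚ} (hqV : shaAn V = (qV : ℂ)) (hqW : shaAn W = (qW : ℂ))
    (hvV : padicValRat p qV = 0) (hvW : padicValRat p qW = 0) :
    BSDp W p ∧ BSDp V p ∧ padicValNat p (V.baseChange (CyclotomicField p ℚ)).tamagawaProduct = 0 := by
  obtain ⟨qV', qW', hqV', hqW', hle⟩ := X4GordCyclotomicPrime.exists_padicVal_shaOrder_add_le_of_facts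
    p V W hK hGr hGZK hmod hp5 C hC hord hsurj hadd hrV hrW hf ϖ ϖ' hϖ hϖ' hO
  have hqq : qV' = qV := by exact_mod_cast hqV'.symm.trans hqV
  have hqq' : qW' = qW := by exact_mod_cast hqW'.symm.trans hqW
  subst hqq hqq'
  rw [hvV, hvW] at hle
  have hV0 : (0 : ℤ) ≤ padicValNat p V.shaOrder := by positivity
  have hW0 : (0 : ℤ) ≤ padicValNat p W.shaOrder := by positivity
  have hT0 : (0 : ℤ) ≤ padicValNat p (V.baseChange (CyclotomicField p ℚ)).tamagawaProduct := by positivity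
  have huW : MissingUpperBoundAt W p := ⟨qW', hqW', by rw [hvW]; linarith⟩
  have huV : MissingUpperBoundAt V p := ⟨qV', hqV', by rw [hvV]; linarith⟩
  refine ⟨bsdp_of_missingPPartAt W p hGZK (by rw [hrW]; exact zero_le_one)
      (missingPPartAt_of_upper_of_shaAn_unit W p huW hqW' hvW),
    bsdp_of_missingPPartAt V p hGZK (by rw [hrV]; exact zero_le_one)
      (missingPPartAt_of_upper_of_shaAn_unit V p huV hqV' hvV), ?_⟩
  have : (padicValNat p (V.baseChange (CyclotomicField p ℚ)).tamagawaProduct : ℤ) ≤ 0 := by linarith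
  exact_mod_cast le_antisymm this hT0

end Facts

end Summit.BirchSwinnertonDyer.Rank1Residual.Additive

end
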